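import Mathlib

/-!
# Crux `HilbertIntegralOverconvergentIsCongruence` (stmt-Langlands-8485), line `Sketch-ideate-r1-k1`,
# section K (Götzky–Koecher): stub `stub_koecher_endgame` (K-G)

Section K of the line proves the Götzky–Koecher principle at the cusp `∞` (Freitag, *Hilbert
Modular Forms*, Ch. I, Prop. 4.9) in analytic, vocabulary-free form.  This file proves the
registered stub `stub_koecher_endgame`, the final growth argument (T6), abstracted over the
Fourier-coefficient function `A ν y` (`ν` a frequency in a unit-stable set `D ⊆ F`, `y ≫ 0` a
height):

* (T2) `hindep`: `A ν y` does not depend on the height `y ≫ 0`;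
* (T3) `hbound`: `‖A ν y‖ ≤ M(y) · exp (2π ∑_σ σ(ν) y_σ)`;
* (T4) `hequiv`: `c · A ν y = A (ν ε⁻¹) (ε • y)` for a totally positive unit `ε`, `c ≠ 0`;
* (T5) `φ(ε) < 1 < ψ(ε)` for the real embeddings `ψ ≠ φ`.

Claim: `A ν y = 0` whenever `φ(ν) < 0`.

Proof.  Write `e = ε`, `e' = ε⁻¹` (as elements of `F`), `ν_m = ν e'^m ∈ D`.  Iterating (T4) and
using (T2) to return to the height `y`, `c^m · A ν y = A ν_m y` (`kG_main`, Step 1).  By (T3),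
`‖A ν y‖ ‖c‖^m ≤ M(y) exp (2π ∑_σ σ(ν) σ(e')^m y_σ)`.  In the exponent the `φ`-term is
`φ(ν) y_φ q^m` with `q = φ(e') = φ(e)⁻¹ > 1` and `φ(ν) y_φ < 0`, while for `σ ≠ φ` one has
`0 ≤ σ(e')^m ≤ 1`, so the other terms are bounded by `B = ∑_{σ ≠ φ} |σ ν| y_σ` (`kG_sum_le`).
Hence `‖A ν y‖ ≤ K r^m exp (-a q^m)` for all `m`, with `r = ‖c‖⁻¹`, `a > 0`, `q > 1`, and the
right-hand side tends to `0` (`kG_tendsto_pow_mul_exp_neg_mul_pow`: its logarithm is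
`q^m (log r · m q^{-m} - a) → -∞`), so `A ν y = 0` (`kG_eq_zero_of_forall_le`).
-/

set_option linter.dupNamespace false -- mandated namespace `Summit.Langlands.Langlands.…` repeats a component

namespace Summit.Langlands.Langlands.Theorems.HilbertIntegralOverconvergentIsCongruence

open NumberField Filter Topology

/-- For `r > 0`, `a > 0` and `q > 1`, the sequence `r ^ m * exp (-(a * q ^ m))` tends to `0`:
the doubly exponential decay beats any geometric growth. -/
theorem kG_tendsto_pow_mul_exp_neg_mul_pow {r a q : ℝ} (hr : 0 < r) (ha : 0 < a) (hq : 1 < q) :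
    Tendsto (fun m : ℕ ↦ r ^ m * Real.exp (-(a * q ^ m))) atTop (𝓝 0) := by
  have hq0 : 0 < q := one_pos.trans hq
  have h1 : Tendsto (fun m : ℕ ↦ (m : ℝ) * q⁻¹ ^ m) atTop (𝓝 0) :=
    tendsto_self_mul_const_pow_of_lt_one (inv_nonneg.mpr hq0.le) (inv_lt_one_of_one_lt₀ hq)
  have h2 : Tendsto (fun m : ℕ ↦ Real.log r * ((m : ℝ) * q⁻¹ ^ m) - a) atTop
      (𝓝 (Real.log r * 0 - a)) :=
    (h1.const_mul (Real.log r)).sub_const a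
  have hneg : Real.log r * 0 - a < 0 := by
    rw [mul_zero, zero_sub, neg_lt_zero]
    exact ha
  have h3 : Tendsto (fun m : ℕ ↦ q ^ m * (Real.log r * ((m : ℝ) * q⁻¹ ^ m) - a)) atTop atBot :=
    (tendsto_pow_atTop_atTop_of_one_lt hq).atTop_mul_neg hneg h2
  refine (Real.tendsto_exp_comp_nhds_zero.mpr h3).congr fun m ↦ ?_
  rw [show q ^ m * (Real.log r * ((m : ℝ) * q⁻¹ ^ m) - a) = (m : ℝ) * Real.log r + -(a * q ^ m) by
      rw [mul_sub, show q ^ m * (Real.log r * ((m : ℝ) * q⁻¹ ^ m))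
          = (m : ℝ) * Real.log r * (q * q⁻¹) ^ m by ring, mul_inv_cancel₀ hq0.ne', one_pow, mul_one]
      ring,
    Real.exp_add, Real.exp_nat_mul, Real.exp_log hr]

/-- If `‖x‖ · C ^ m ≤ K · exp (B - a · q ^ m)` for every `m : ℕ`, where `C > 0`, `a > 0` and
`q > 1`, then `x = 0`. -/
theorem kG_eq_zero_of_forall_le {x : ℂ} (C K B a q : ℝ) (hC : 0 < C) (ha : 0 < a) (hq : 1 < q)
    (h : ∀ m : ℕ, ‖x‖ * C ^ m ≤ K * Real.exp (B - a * q ^ m)) : x = 0 := by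
  have hK : ∀ m : ℕ, ‖x‖ ≤ max K 0 * Real.exp B * (C⁻¹ ^ m * Real.exp (-(a * q ^ m))) := by
    intro m
    have hCm : 0 ≤ C⁻¹ ^ m := pow_nonneg (inv_nonneg.mpr hC.le) m
    calc ‖x‖ = ‖x‖ * C ^ m * C⁻¹ ^ m := by
          rw [mul_assoc, ← mul_pow, mul_inv_cancel₀ hC.ne', one_pow, mul_one]
      _ ≤ K * Real.exp (B - a * q ^ m) * C⁻¹ ^ m := mul_le_mul_of_nonneg_right (h m) hCm
      _ ≤ max K 0 * Real.exp (B - a * q ^ m) * C⁻¹ ^ m :=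
          mul_le_mul_of_nonneg_right
            (mul_le_mul_of_nonneg_right (le_max_left _ _) (Real.exp_pos _).le) hCm
      _ = max K 0 * Real.exp B * (C⁻¹ ^ m * Real.exp (-(a * q ^ m))) := by
          rw [sub_eq_add_neg, Real.exp_add]
          ring
  have ht := (kG_tendsto_pow_mul_exp_neg_mul_pow (inv_pos.mpr hC) ha hq).const_mul
    (max K 0 * Real.exp B)
  rw [mul_zero] at ht
  exact norm_le_zero_iff.mp (ge_of_tendsto' ht hK)

/-- Splitting off the `φ`-term of `∑_σ u_σ t_σ^m y_σ`: if `0 ≤ t_σ` for all `σ`, `t_σ ≤ 1` for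
`σ ≠ φ` and `0 ≤ y_σ`, the remaining terms are bounded by `∑_{σ ≠ φ} |u_σ| y_σ`, uniformly in `m`. -/
theorem kG_sum_le {ι : Type} [Fintype ι] [DecidableEq ι] (φ : ι) (u t y : ι → ℝ) (m : ℕ)
    (ht0 : ∀ σ, 0 ≤ t σ) (ht1 : ∀ σ, σ ≠ φ → t σ ≤ 1) (hy : ∀ σ, 0 ≤ y σ) :
    ∑ σ, u σ * t σ ^ m * y σ ≤ u φ * t φ ^ m * y φ + ∑ σ ∈ {φ}ᶜ, |u σ| * y σ := by
  rw [Fintype.sum_eq_add_sum_compl φ]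
  refine add_le_add le_rfl (Finset.sum_le_sum fun σ hσ ↦ ?_)
  have hne : σ ≠ φ := by simpa using hσ
  have h1 : u σ * t σ ^ m ≤ |u σ| :=
    (le_abs_self _).trans (by
      rw [abs_mul, abs_pow, abs_of_nonneg (ht0 σ)]
      exact mul_le_of_le_one_right (abs_nonneg _) (pow_le_one₀ (ht0 σ) (ht1 σ hne)))
  exact mul_le_mul_of_nonneg_right h1 (hy σ)

/-- The growth argument with the unit `ε` and its inverse replaced by field elements `e`, `e'`
with `e * e' = 1` (so that no coercion bookkeeping is needed): under (T2)–(T5), `A ν y = 0`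
whenever `φ ν < 0`. -/
theorem kG_main (F : Type) [Field F] [NumberField F] (D : Set F) (e e' : F) (he : e * e' = 1)
    (hD : ∀ ν ∈ D, ν * e' ∈ D) (A : F → ((F →+* ℝ) → ℝ) → ℂ)
    (hindep : ∀ ν ∈ D, ∀ y y' : (F →+* ℝ) → ℝ, (∀ σ, 0 < y σ) → (∀ σ, 0 < y' σ) → A ν y = A ν y')
    (M : ((F →+* ℝ) → ℝ) → ℝ)
    (hbound : ∀ ν ∈ D, ∀ y : (F →+* ℝ) → ℝ, (∀ σ, 0 < y σ) →
      ‖A ν y‖ ≤ M y * Real.exp (2 * Real.pi * ∑ σ : F →+* ℝ, σ ν * y σ))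
    (hεpos : ∀ σ : F →+* ℝ, 0 < σ e) (φ : F →+* ℝ) (hεφ : φ e < 1)
    (hεψ : ∀ ψ : F →+* ℝ, ψ ≠ φ → 1 < ψ e) (c : ℂ) (hc : c ≠ 0)
    (hequiv : ∀ ν ∈ D, ∀ y : (F →+* ℝ) → ℝ, (∀ σ, 0 < y σ) →
      c * A ν y = A (ν * e') (fun σ ↦ σ e * y σ))
    (ν : F) (hνD : ν ∈ D) (hφν : φ ν < 0) (y : (F →+* ℝ) → ℝ) (hy : ∀ σ, 0 < y σ) :
    A ν y = 0 := by
  classical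
  -- Step 1: iterate the unit equivariance (T4), returning to the height `y` by (T2).
  have key : ∀ m : ℕ, ν * e' ^ m ∈ D ∧ c ^ m * A ν y = A (ν * e' ^ m) y := by
    intro m
    induction m with
    | zero => simp [hνD]
    | succ m ih =>
      obtain ⟨hm, hcm⟩ := ih
      have hm' : ν * e' ^ (m + 1) ∈ D := by
        rw [pow_succ, ← mul_assoc]
        exact hD _ hm
      refine ⟨hm', ?_⟩
      rw [pow_succ', mul_assoc, hcm, hequiv _ hm y hy, mul_assoc, ← pow_succ]
      exact hindep _ hm' _ _ (fun σ ↦ mul_pos (hεpos σ) (hy σ)) hy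
  -- The conjugates of `e'` are the inverses of those of `e`.
  have he' : ∀ σ : F →+* ℝ, σ e' = (σ e)⁻¹ := fun σ ↦
    eq_inv_of_mul_eq_one_right (by rw [← map_mul, he, map_one])
  have ht0 : ∀ σ : F →+* ℝ, 0 ≤ σ e' := fun σ ↦ by
    rw [he']
    exact inv_nonneg.mpr (hεpos σ).le
  have ht1 : ∀ σ : F →+* ℝ, σ ≠ φ → σ e' ≤ 1 := fun σ hσ ↦ by
    rw [he']
    exact inv_le_one_of_one_le₀ (hεψ σ hσ).le
  have hq : 1 < φ e' := by
    rw [he']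
    exact (one_lt_inv₀ (hεpos φ)).mpr hεφ
  have ha : 0 < 2 * Real.pi * -(φ ν * y φ) :=
    mul_pos (by positivity) (neg_pos.mpr (mul_neg_of_neg_of_pos hφν (hy φ)))
  -- Steps 2–4: the bound (T3) along the sequence `ν e'^m` and the limit.
  refine kG_eq_zero_of_forall_le ‖c‖ (max (M y) 0) (2 * Real.pi * ∑ σ ∈ {φ}ᶜ, |σ ν| * y σ)
    (2 * Real.pi * -(φ ν * y φ)) (φ e') (norm_pos_iff.mpr hc) ha hq fun m ↦ ?_
  obtain ⟨hm, hcm⟩ := key m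
  have hb := hbound _ hm y hy
  rw [← hcm, norm_mul, norm_pow] at hb
  simp only [map_mul, map_pow] at hb
  have hs : ∑ σ, σ ν * σ e' ^ m * y σ ≤ φ ν * φ e' ^ m * y φ + ∑ σ ∈ {φ}ᶜ, |σ ν| * y σ :=
    kG_sum_le φ (fun σ : F →+* ℝ ↦ σ ν) (fun σ ↦ σ e') y m ht0 ht1 fun σ ↦ (hy σ).le
  calc ‖A ν y‖ * ‖c‖ ^ m = ‖c‖ ^ m * ‖A ν y‖ := mul_comm _ _
    _ ≤ M y * Real.exp (2 * Real.pi * ∑ σ, σ ν * σ e' ^ m * y σ) := hb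
    _ ≤ max (M y) 0 * Real.exp (2 * Real.pi * ∑ σ, σ ν * σ e' ^ m * y σ) :=
        mul_le_mul_of_nonneg_right (le_max_left _ _) (Real.exp_pos _).le
    _ ≤ max (M y) 0 * Real.exp (2 * Real.pi * (φ ν * φ e' ^ m * y φ + ∑ σ ∈ {φ}ᶜ, |σ ν| * y σ)) :=
        mul_le_mul_of_nonneg_left
          (Real.exp_le_exp.mpr (mul_le_mul_of_nonneg_left hs (by positivity))) (le_max_right _ _)
    _ = max (M y) 0 * Real.exp (2 * Real.pi * ∑ σ ∈ {φ}ᶜ, |σ ν| * y σ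
          - 2 * Real.pi * -(φ ν * y φ) * φ e' ^ m) := by
        congr 2
        ring

/-- `ε · ε⁻¹ = 1` in `F` for a unit `ε` of the ring of integers. -/
theorem kG_units_coe_mul_inv (F : Type) [Field F] [NumberField F] (ε : (𝓞 F)ˣ) :
    ((ε : 𝓞 F) : F) * (((ε⁻¹ : (𝓞 F)ˣ) : 𝓞 F) : F) = 1 := by
  show algebraMap (𝓞 F) F (ε : 𝓞 F) * algebraMap (𝓞 F) F ((ε⁻¹ : (𝓞 F)ˣ) : 𝓞 F) = 1
  rw [← map_mul, Units.mul_inv, map_one]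

/-- **stub K-G — `stub_koecher_endgame`** ((T6): the growth argument of the Götzky–Koecher
principle, Freitag, *Hilbert Modular Forms*, Ch. I, Prop. 4.9).  Abstract over the coefficient
function `A ν y`: if it is independent of the height `y ≫ 0` (T2), bounded by `M(y) e^{2π S(νy)}`
with `M` independent of `ν` (T3), satisfies `c · A ν y = A (νε⁻¹) (εy)` for a totally positive
unit `ε` with `c ≠ 0` (T4), where `φ(ε) < 1 < ψ(ε)` for `ψ ≠ φ` (T5), then `A ν y = 0` whenever
`φ(ν) < 0`: `|A ν y₀| ≤ |c|^{-m} M(y₀) exp(2π S(νε^{-m} y₀))` and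
`S(νε^{-m}y₀) ≤ φ(ν) y₀φ φ(ε)^{-m} + C → -∞` geometrically in `m`. -/
theorem stub_koecher_endgame (F : Type) [Field F] [NumberField F] (D : Set F)
    (hD : ∀ ν ∈ D, ∀ u : (𝓞 F)ˣ, ν * ((u : 𝓞 F) : F) ∈ D)
    (A : F → ((F →+* ℝ) → ℝ) → ℂ)
    (hindep : ∀ ν ∈ D, ∀ y y' : (F →+* ℝ) → ℝ, (∀ σ, 0 < y σ) → (∀ σ, 0 < y' σ) → A ν y = A ν y')
    (M : ((F →+* ℝ) → ℝ) → ℝ)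
    (hbound : ∀ ν ∈ D, ∀ y : (F →+* ℝ) → ℝ, (∀ σ, 0 < y σ) →
      ‖A ν y‖ ≤ M y * Real.exp (2 * Real.pi * ∑ σ : F →+* ℝ, σ ν * y σ))
    (ε : (𝓞 F)ˣ) (hεpos : ∀ σ : F →+* ℝ, 0 < σ ((ε : 𝓞 F) : F)) (φ : F →+* ℝ)
    (hεφ : φ ((ε : 𝓞 F) : F) < 1) (hεψ : ∀ ψ : F →+* ℝ, ψ ≠ φ → 1 < ψ ((ε : 𝓞 F) : F))
    (c : ℂ) (hc : c ≠ 0)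
    (hequiv : ∀ ν ∈ D, ∀ y : (F →+* ℝ) → ℝ, (∀ σ, 0 < y σ) →
      c * A ν y = A (ν * ((ε⁻¹ : (𝓞 F)ˣ) : 𝓞 F)) (fun σ ↦ σ ((ε : 𝓞 F) : F) * y σ))
    (ν : F) (hνD : ν ∈ D) (hφν : φ ν < 0) (y : (F →+* ℝ) → ℝ) (hy : ∀ σ, 0 < y σ) :
    A ν y = 0 :=
  kG_main F D ((ε : 𝓞 F) : F) (((ε⁻¹ : (𝓞 F)ˣ) : 𝓞 F) : F) (kG_units_coe_mul_inv F ε)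
    (fun μ hμ ↦ hD μ hμ ε⁻¹) A hindep M hbound hεpos φ hεφ hεψ c hc hequiv ν hνD hφν y hy

end Summit.Langlands.Langlands.Theorems.HilbertIntegralOverconvergentIsCongruence
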